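import Literature.AlgebraicGeometry.Deligne1982.WeilSpaceComplexification
import Literature.AlgebraicGeometry.Deligne1982.WeilTypeCMQuadratic
import Literature.AlgebraicGeometry.HodgeTheory.AbelianVarietyEndomorphismsHOne
import Literature.AlgebraicGeometry.HodgeTheory.WeilClassesFieldRationalSpan
import Literature.AlgebraicGeometry.HodgeTheory.DegreeOneHodgeTypes
import Literature.AlgebraicGeometry.HodgeTheory.WeilClassesHodgeType
import Literature.AlgebraicGeometry.HodgeTheory.HodgeTypeExteriorProduct
import Literature.AlgebraicGeometry.Motives.HyperbolicWeilTypeProduct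
import HarnessLib

/-!
# Crux X1 `CYFormCarrierEight` (route `CYFormCasimir`, stmt-HodgeConjecture-23493), helper file 1:
# a Calabi–Yau form from an anti-commuting involution

research route conditional on HC_CM; not a corollary. Nothing here proves HC, HC_CM, the rung H2, X1 or the
route: SUPPORT file for the BC5 rung `stub_carrier_at_CM_point` of `Cruxes/CYFormCarrierEight/Lines/birth.lean`
(the CY-form half of the rung at the CM anchor; the anchor itself is helper file 2).

For a complex abelian variety `A` with `φ ≫ φ = -d` (`d > 0`), `E₊ = ⋀^{2n}W = weilClassesPlus A φ n d`,
`E₋ = ⋀^{2n}W^* = weilClassesMinus A φ n d` (`W`, `W^*` the `± i√d`-eigenspaces of `φ^*` on `H¹`; §2 proves these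
identifications from the tree's pencil calculus), and an endomorphism `σ` ANTI-COMMUTING with `φ`
(`σ ≫ φ = -(φ ≫ σ)`, `σ ≫ σ = 𝟙`): `σ^*` exchanges `⋀^{2n}W` and `⋀^{2n}W^*`, and for `dim A = 8`, `n = 2`,
`T := (𝟙 + σ^*)(⋀⁴W^*)` satisfies the five `T`-clauses of X1 (`exists_cyForm_of_antiInvolution`): `T ≤ ⋀⁴W ⊔ ⋀⁴W^*`,
`T ∩ ⋀⁴W = 0`, `dim T = C(8,4) = 70`, `T` spanned by rational classes (`W_K ⊗ ℂ` is, Moonen–Zarhin §1; `𝟙 + σ^*`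
is rational) and by pure-type classes (`W^* = W^*∩H^{1,0} ⊕ W^*∩H^{0,1}`, types add under `⌣`, `σ^*` preserves
types). This is Friedman–Laza's `Fix(⋆)` (Prop. 37) with the Hodge star replaced by a geometric involution.

References: FriedmanLaza2013 (§3.5 Prop. 37), vanGeemen1994HodgeAV (4.9, Lemma 5.2, Thm. 6.12),
MoonenZarhin1998WeilClasses (§1), VoisinHodgeI2002 (§7.1–7.3).
-/

-- `Summit.HodgeConjecture.HodgeConjecture.…` is the tree's mandated summit/problem namespace (single-problem summit).
set_option linter.dupNamespace false
noncomputable section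

open CategoryTheory Polynomial
open Literature.AlgebraicTopology.SingularHomology
open Literature.AlgebraicGeometry.Motives
open Literature.AlgebraicGeometry.HodgeTheory
open Literature.AlgebraicGeometry.Deligne1982

namespace Summit.HodgeConjecture.HodgeConjecture.Theorems.CYFormCarrier

/-! ## §1 Linear algebra of a graph `T = (1 + s)(E₋)` -/

section LinearAlgebra

variable {K V : Type*} [Field K] [AddCommGroup V] [Module K V]

/-- If `L` preserves a property `P` and `S` is spanned by its `P`-classes, then `L(S)` is spanned by its
`P`-classes. [folklore] -/
theorem map_le_span_sep (L : V →ₗ[K] V) (S : Submodule K V) (P : V → Prop)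
    (hP : ∀ c, P c → P (L c)) (hS : S ≤ Submodule.span K {c | c ∈ S ∧ P c}) :
    S.map L ≤ Submodule.span K {c | c ∈ S.map L ∧ P c} := by
  refine (Submodule.map_mono hS).trans ?_
  rw [Submodule.map_span, Submodule.span_le]
  rintro _ ⟨c, ⟨hcS, hcP⟩, rfl⟩
  exact Submodule.subset_span ⟨Submodule.mem_map_of_mem hcS, hP c hcP⟩

variable (s : V →ₗ[K] V) (Ep Em : Submodule K V)

/-- `(1 + s)(E₋) ≤ E₊ ⊔ E₋` when `s(E₋) ≤ E₊`. [folklore] -/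
theorem map_id_add_le_sup (hs : Em.map s ≤ Ep) : Em.map (LinearMap.id + s) ≤ Ep ⊔ Em := by
  rintro _ ⟨x, hx, rfl⟩
  rw [LinearMap.add_apply, LinearMap.id_apply, add_comm]
  exact Submodule.add_mem_sup (hs (Submodule.mem_map_of_mem hx)) hx

/-- `(1 + s)(E₋) ∩ E₊ = 0` when `s(E₋) ≤ E₊` and `E₊ ∩ E₋ = 0`. [folklore] -/
theorem map_id_add_inf_eq_bot (hs : Em.map s ≤ Ep) (h0 : Ep ⊓ Em = ⊥) :
    Em.map (LinearMap.id + s) ⊓ Ep = ⊥ := by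
  rw [eq_bot_iff]
  rintro y ⟨⟨x, hx, rfl⟩, hy⟩
  have hsx : s x ∈ Ep := hs (Submodule.mem_map_of_mem hx)
  have hxEp : x ∈ Ep := by
    have h := Ep.sub_mem hy hsx
    rwa [LinearMap.add_apply, LinearMap.id_apply, add_sub_cancel_right] at h
  have hx0 : x = 0 := by
    rw [← Submodule.mem_bot K, ← h0]; exact ⟨hxEp, hx⟩
  rw [Submodule.mem_bot, hx0, map_zero]

/-- `1 + s` is injective on `E₋` when `s(E₋) ≤ E₊` and `E₊ ∩ E₋ = 0`. [folklore] -/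
theorem injOn_id_add (hs : Em.map s ≤ Ep) (h0 : Ep ⊓ Em = ⊥) :
    Function.Injective ((LinearMap.id + s).domRestrict Em) := by
  rw [← LinearMap.ker_eq_bot, eq_bot_iff]
  rintro ⟨x, hx⟩ hx0
  rw [LinearMap.mem_ker, LinearMap.domRestrict_apply, LinearMap.add_apply, LinearMap.id_apply] at hx0
  have hsx : s x ∈ Ep := hs (Submodule.mem_map_of_mem hx)
  have hxEp : x ∈ Ep := by
    have : x = -s x := eq_neg_of_add_eq_zero_left hx0
    rw [this]; exact Ep.neg_mem hsx
  have : x = 0 := by rw [← Submodule.mem_bot K, ← h0]; exact ⟨hxEp, hx⟩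
  rw [Submodule.mem_bot]
  exact Subtype.ext this

/-- `dim (1 + s)(E₋) = dim E₋` when `1 + s` is injective on `E₋`. [folklore] -/
theorem finrank_map_id_add [FiniteDimensional K V] (hs : Em.map s ≤ Ep) (h0 : Ep ⊓ Em = ⊥) :
    Module.finrank K (Em.map (LinearMap.id + s)) = Module.finrank K Em := by
  have h := LinearMap.finrank_range_of_inj (injOn_id_add s Ep Em hs h0)
  rwa [LinearMap.range_domRestrict] at h

/-- `(1 + s)(E₊) ≤ (1 + s)(E₋)` when `s(E₊) ≤ E₋` and `s ∘ s = 1`: `x + s x = s(s x) + s x`. [folklore] -/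
theorem map_id_add_le_of_sq (hs' : Ep.map s ≤ Em) (hss : ∀ x, s (s x) = x) :
    Ep.map (LinearMap.id + s) ≤ Em.map (LinearMap.id + s) := by
  rintro _ ⟨x, hx, rfl⟩
  refine ⟨s x, hs' (Submodule.mem_map_of_mem hx), ?_⟩
  rw [LinearMap.add_apply, LinearMap.id_apply, LinearMap.add_apply, LinearMap.id_apply, hss, add_comm]

/-- `(1 + s)(E₊ ⊔ E₋) = (1 + s)(E₋)` under the same hypotheses. [folklore] -/
theorem map_id_add_sup_eq (hs' : Ep.map s ≤ Em) (hss : ∀ x, s (s x) = x) :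
    (Ep ⊔ Em).map (LinearMap.id + s) = Em.map (LinearMap.id + s) := by
  rw [Submodule.map_sup]; exact sup_eq_right.2 (map_id_add_le_of_sq s Ep Em hs' hss)

end LinearAlgebra

/-! ## §2 `⋀⁴W`, `⋀⁴W^*` as images of exterior powers of the eigenspaces, and an anti-commuting `σ` -/

section Eigen

variable {A : AbelianVariety ℂ} {d : ℕ} {φ σ : A ⟶ A}

/-- **`E₊ = ⋀^{2n}W`**: the `+`-Weil eigenclasses in degree `2n` are the image under the cup-product isomorphism
`⋀^{2n} H¹ ⥲ H^{2n}` of `⋀^{2n}` of the `i√d`-eigenspace `W` of `φ^*` (pencil calculus of the tree).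
[cite: MoonenZarhin1998WeilClasses, §1] [cite: vanGeemen1994HodgeAV, proof of Thm. 6.12] -/
theorem weilClassesPlus_eq_map_range (hd : 0 < d) (hφ : φ ≫ φ = -(d • 𝟙 A)) (n : ℕ) :
    weilClassesPlus A φ n d =
      (LinearMap.range (exteriorPower.map (2 * n)
        (Module.End.eigenspace (complexBetti.map φ.hom.hom.hom 1).hom
          (Complex.I * (Real.sqrt d : ℂ))).subtype)).map
        (wedgeToCup ℂ (ComplexPoints A.X) (2 * n)) := by
  haveI := finite_complexBetti_abelianVariety A 1
  -- `φ^*` is diagonalisable: `H¹ = W ⊕ W^*` (as in `BiquadraticSecantLift.iSup_eigenspace_eq_top_of_comp_self`)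
  have hsup : ⨆ μ : ℂ, Module.End.eigenspace (complexBetti.map φ.hom.hom.hom 1).hom μ = ⊤ :=
    eq_top_iff.2 ((eigenspace_sup_eigenspace_neg_eq_top hd hφ).ge.trans (sup_le
      (le_iSup (fun μ : ℂ => Module.End.eigenspace (complexBetti.map φ.hom.hom.hom 1).hom μ) _)
      (le_iSup (fun μ : ℂ => Module.End.eigenspace (complexBetti.map φ.hom.hom.hom 1).hom μ) _)))
  have hχ : (fun x y : ℕ => ((x : ℂ) + (y : ℂ) * Complex.I * (Real.sqrt d : ℂ)) ^ (2 * n)) =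
      fun x y : ℕ => ((x : ℂ) + y * (Complex.I * (Real.sqrt d : ℂ))) ^ (2 * n) := by
    funext x y; ring
  rw [weilClassesPlus, hχ, pullbackEigenclasses_eq_map_wedgeToCup,
    ← range_map_eigenspace_eq_pencilEigenspace ℂ (complexBetti A.X 1) (complexBetti.map φ.hom.hom.hom 1).hom hsup]

/-- **`E₋ = ⋀^{2n}W^*`** (the `-i√d`-eigenspace). [cite: MoonenZarhin1998WeilClasses, §1] [cite: vanGeemen1994HodgeAV, proof of Thm. 6.12] -/
theorem weilClassesMinus_eq_map_range (hd : 0 < d) (hφ : φ ≫ φ = -(d • 𝟙 A)) (n : ℕ) :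
    weilClassesMinus A φ n d =
      (LinearMap.range (exteriorPower.map (2 * n)
        (Module.End.eigenspace (complexBetti.map φ.hom.hom.hom 1).hom
          (-(Complex.I * (Real.sqrt d : ℂ)))).subtype)).map
        (wedgeToCup ℂ (ComplexPoints A.X) (2 * n)) := by
  haveI := finite_complexBetti_abelianVariety A 1
  have hsup : ⨆ μ : ℂ, Module.End.eigenspace (complexBetti.map φ.hom.hom.hom 1).hom μ = ⊤ :=
    eq_top_iff.2 ((eigenspace_sup_eigenspace_neg_eq_top hd hφ).ge.trans (sup_le
      (le_iSup (fun μ : ℂ => Module.End.eigenspace (complexBetti.map φ.hom.hom.hom 1).hom μ) _)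
      (le_iSup (fun μ : ℂ => Module.End.eigenspace (complexBetti.map φ.hom.hom.hom 1).hom μ) _)))
  have hχ : (fun x y : ℕ => ((x : ℂ) - (y : ℂ) * Complex.I * (Real.sqrt d : ℂ)) ^ (2 * n)) =
      fun x y : ℕ => ((x : ℂ) + y * (-(Complex.I * (Real.sqrt d : ℂ)))) ^ (2 * n) := by
    funext x y; ring
  rw [weilClassesMinus, hχ, pullbackEigenclasses_eq_map_wedgeToCup,
    ← range_map_eigenspace_eq_pencilEigenspace ℂ (complexBetti A.X 1) (complexBetti.map φ.hom.hom.hom 1).hom hsup]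

/-- **`dim E₋ = C(dim W^*, 2n)`**: the comparison map and `⋀^{2n}` of the inclusion `W^* ↪ H¹` are injective.
[cite: vanGeemen1994HodgeAV, proof of Thm. 6.12] -/
theorem finrank_weilClassesMinus_eq_choose (hd : 0 < d) (hφ : φ ≫ φ = -(d • 𝟙 A)) (n : ℕ) :
    Module.finrank ℂ (weilClassesMinus A φ n d) =
      (Module.finrank ℂ (Module.End.eigenspace (complexBetti.map φ.hom.hom.hom 1).hom
        (-(Complex.I * (Real.sqrt d : ℂ))))).choose (2 * n) := by
  haveI := finite_complexBetti_abelianVariety A 1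
  have hΛ := AbelianVariety.hasExteriorCohomologyH1_complexPoints A
  rw [weilClassesMinus_eq_map_range hd hφ n,
    ← (Submodule.equivMapOfInjective _ (hΛ (2 * n)).1 _).finrank_eq,
    LinearMap.finrank_range_of_inj (exteriorPower.map_injective_field (Submodule.injective_subtype _)),
    exteriorPower.finrank_eq]

/-- **`dim W^* = dim A`** (`2 dim W^* = dim H¹ = 2 dim A`). [cite: vanGeemen1994HodgeAV, 4.9] -/
theorem finrank_eigenspace_neg_eq_dim (hd : 0 < d) (hφ : φ ≫ φ = -(d • 𝟙 A)) :
    Module.finrank ℂ (Module.End.eigenspace (complexBetti.map φ.hom.hom.hom 1).hom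
        (-(Complex.I * (Real.sqrt d : ℂ)))) = A.dim := by
  have h := two_mul_finrank_eigenspace_eq hd hφ
  rw [finrank_eigenspace_eq_finrank_eigenspace_neg hd hφ,
    abelianVarietyCohomologyExteriorH1_holds.finrank_one A] at h
  omega

/-- **`E₊ ∩ E₋ = 0`** in every degree `2n ≥ 2` (distinct eigen-characters). [cite: vanGeemen1994HodgeAV, proof of Thm. 6.12] -/
theorem weilClassesPlus_inf_weilClassesMinus {n : ℕ} (hn : 0 < n) (hd : 0 < d) :
    weilClassesPlus A φ n d ⊓ weilClassesMinus A φ n d = ⊥ :=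
  (disjoint_weilClassesPlus_weilClassesMinus A φ hn hd).eq_bot

/-- `(f ≫ g)^* c = f^* (g^* c)` on `Hᵏ(A(ℂ); ℂ)`, element form. [folklore] -/
theorem map_comp_hom_apply {B C : AbelianVariety ℂ} (f : A ⟶ B) (g : B ⟶ C) (k : ℕ) (c : complexBetti C.X k) :
    (complexBetti.map (f ≫ g).hom.hom.hom k).hom c =
      (complexBetti.map f.hom.hom.hom k).hom ((complexBetti.map g.hom.hom.hom k).hom c) := by
  change complexBetti.map (f.hom.hom.hom ≫ g.hom.hom.hom) k c = _
  rw [complexBetti.map_comp]; rfl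

/-- `(-f)^* c = -(f^* c)` on `H¹`, element form (`complexBetti_map_neg_one`). [cite: LangeBirkenhake1992, §1.1 (p. 19)] -/
theorem map_neg_one_hom_apply {B : AbelianVariety ℂ} (f : A ⟶ B) (c : complexBetti B.X 1) :
    (complexBetti.map (-f).hom.hom.hom 1).hom c = -((complexBetti.map f.hom.hom.hom 1).hom c) := by
  rw [complexBetti_map_neg_one]
  rfl

/-- **An endomorphism anti-commuting with `φ` exchanges the eigenspaces of `φ^*` on `H¹`**:
`φ^*(σ^* v) = (φ ≫ σ)^* v = -(σ ≫ φ)^* v = -σ^*(φ^* v) = -μ σ^* v`. [cite: vanGeemen1994HodgeAV, 4.8] -/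
theorem map_mem_eigenspace_neg_of_anticomm (hσ : σ ≫ φ = -(φ ≫ σ)) {μ : ℂ} {v : complexBetti A.X 1}
    (hv : v ∈ Module.End.eigenspace (complexBetti.map φ.hom.hom.hom 1).hom μ) :
    (complexBetti.map σ.hom.hom.hom 1).hom v ∈
      Module.End.eigenspace (complexBetti.map φ.hom.hom.hom 1).hom (-μ) := by
  rw [Module.End.mem_eigenspace_iff] at hv ⊢
  have hφσ : φ ≫ σ = -(σ ≫ φ) := by rw [hσ, neg_neg]
  rw [← map_comp_hom_apply, hφσ, map_neg_one_hom_apply, map_comp_hom_apply, hv, map_smul, neg_smul]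

/-- **`σ^*` on `H^{2n}` maps `⋀^{2n}V_μ` into `⋀^{2n}V_{-μ}`** (naturality of the cup-product isomorphism,
`complexBetti_map_wedgeToCup`, and functoriality of `⋀^{2n}`). [cite: HatcherAT2002, §3.2 Prop. 3.10] -/
theorem map_range_eigenspace_le (hσ : σ ≫ φ = -(φ ≫ σ)) (μ : ℂ) (k : ℕ) :
    ((LinearMap.range (exteriorPower.map k
        (Module.End.eigenspace (complexBetti.map φ.hom.hom.hom 1).hom μ).subtype)).map
        (wedgeToCup ℂ (ComplexPoints A.X) k)).map (complexBetti.map σ.hom.hom.hom k).hom ≤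
      (LinearMap.range (exteriorPower.map k
        (Module.End.eigenspace (complexBetti.map φ.hom.hom.hom 1).hom (-μ)).subtype)).map
        (wedgeToCup ℂ (ComplexPoints A.X) k) := by
  set Vμ := Module.End.eigenspace (complexBetti.map φ.hom.hom.hom 1).hom μ with hVμ
  set Vν := Module.End.eigenspace (complexBetti.map φ.hom.hom.hom 1).hom (-μ) with hVν
  -- the restriction `r : V_μ → V_{-μ}` of `σ^*`
  set r : Vμ →ₗ[ℂ] Vν := LinearMap.codRestrict Vν ((complexBetti.map σ.hom.hom.hom 1).hom ∘ₗ Vμ.subtype)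
    (fun w => map_mem_eigenspace_neg_of_anticomm hσ w.2) with hr
  have hcomp : Vν.subtype ∘ₗ r = (complexBetti.map σ.hom.hom.hom 1).hom ∘ₗ Vμ.subtype :=
    LinearMap.subtype_comp_codRestrict _ _ _
  rintro _ ⟨_, ⟨_, ⟨w, rfl⟩, rfl⟩, rfl⟩
  refine ⟨exteriorPower.map k Vν.subtype (exteriorPower.map k r w), ⟨_, rfl⟩, ?_⟩
  have key : exteriorPower.map k Vν.subtype (exteriorPower.map k r w) =
      exteriorPower.map k (complexBetti.map σ.hom.hom.hom 1).hom (exteriorPower.map k Vμ.subtype w) := by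
    change (exteriorPower.map k Vν.subtype ∘ₗ exteriorPower.map k r) w =
      (exteriorPower.map k (complexBetti.map σ.hom.hom.hom 1).hom ∘ₗ exteriorPower.map k Vμ.subtype) w
    rw [← exteriorPower.map_comp, ← exteriorPower.map_comp, hcomp]
  change _ = complexBetti.map σ.hom.hom.hom k (wedgeToCup ℂ (ComplexPoints A.X) k _)
  rw [complexBetti_map_wedgeToCup, key]

/-- **`σ^*(⋀^{2n}W^*) ≤ ⋀^{2n}W`.** [cite: vanGeemen1994HodgeAV, proof of Thm. 6.12] -/
theorem map_weilClassesMinus_le_weilClassesPlus (hd : 0 < d) (hφ : φ ≫ φ = -(d • 𝟙 A))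
    (hσ : σ ≫ φ = -(φ ≫ σ)) (n : ℕ) :
    (weilClassesMinus A φ n d).map (complexBetti.map σ.hom.hom.hom (2 * n)).hom ≤ weilClassesPlus A φ n d := by
  have h := map_range_eigenspace_le (A := A) (φ := φ) hσ (-(Complex.I * (Real.sqrt d : ℂ))) (2 * n)
  rw [neg_neg] at h
  rwa [weilClassesMinus_eq_map_range hd hφ, weilClassesPlus_eq_map_range hd hφ]

/-- **`σ^*(⋀^{2n}W) ≤ ⋀^{2n}W^*`.** [cite: vanGeemen1994HodgeAV, proof of Thm. 6.12] -/
theorem map_weilClassesPlus_le_weilClassesMinus (hd : 0 < d) (hφ : φ ≫ φ = -(d • 𝟙 A))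
    (hσ : σ ≫ φ = -(φ ≫ σ)) (n : ℕ) :
    (weilClassesPlus A φ n d).map (complexBetti.map σ.hom.hom.hom (2 * n)).hom ≤ weilClassesMinus A φ n d := by
  have h := map_range_eigenspace_le (A := A) (φ := φ) hσ (Complex.I * (Real.sqrt d : ℂ)) (2 * n)
  rwa [weilClassesMinus_eq_map_range hd hφ, weilClassesPlus_eq_map_range hd hφ]

/-- `σ^* σ^* = (σ ≫ σ)^* = 𝟙` on `H^k` for an involution `σ`. [folklore] -/
theorem map_map_of_comp_self_eq_id (hσσ : σ ≫ σ = 𝟙 A) (k : ℕ) (x : complexBetti A.X k) :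
    (complexBetti.map σ.hom.hom.hom k).hom ((complexBetti.map σ.hom.hom.hom k).hom x) = x := by
  rw [← map_comp_hom_apply, hσσ]
  change complexBetti.map (𝟙 A.X) k x = x
  rw [complexBetti.map_id]; rfl

end Eigen

/-! ## §3 `⋀^{2n}W^*` is spanned by pure-type classes; `⋀^{2n}W ⊕ ⋀^{2n}W^*` by rational classes -/

section Spans

variable {A : AbelianVariety ℂ} {d : ℕ} {φ : A ⟶ A}

/-- **`⋀^{2n}W^*` is spanned by classes of pure Hodge type `(p, q)`, `p + q = 2n`**: `W^* = W^*∩H^{1,0} ⊕ W^*∩H^{0,1}`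
(`eigenspace_eq_sup`), so `⋀^{2n}W^*` is spanned by wedges of pure degree-one classes, and types add under `⌣`
(`isOfHodgeType_cupPowOne`). [cite: VoisinHodgeI2002, §7.1.2] [cite: vanGeemen1994HodgeAV, proof of Lemma 5.2] -/
theorem weilClassesMinus_le_span_pureType (hd : 0 < d) (hφ : φ ≫ φ = -(d • 𝟙 A)) {m : ℕ}
    (hX : IsSmoothProjective m A.X) {n : ℕ} (hn : 0 < n) :
    weilClassesMinus A φ n d ≤ Submodule.span ℂ {c | c ∈ weilClassesMinus A φ n d ∧
      ∃ p q : ℕ, p + q = 2 * n ∧ IsOfHodgeType m A.X (2 * n) p q c} := by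
  classical
  set V := Module.End.eigenspace (complexBetti.map φ.hom.hom.hom 1).hom (-(Complex.I * (Real.sqrt d : ℂ)))
    with hV
  -- pure-type vectors span `V = W^*`
  set P : Set V := {v | (v : complexBetti A.X 1) ∈ hodgeOneZero hX ∨
    (v : complexBetti A.X 1) ∈ hodgeZeroOne hX} with hP
  have hPspan : Submodule.span ℂ P = ⊤ := by
    refine eq_top_iff.2 fun v _ => ?_
    have hv : (v : complexBetti A.X 1) ∈ V ⊓ hodgeOneZero hX ⊔ V ⊓ hodgeZeroOne hX := by
      rw [← eigenspace_eq_sup hX φ.hom.hom.hom]; exact v.2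
    obtain ⟨a, ha, b, hb, hab⟩ := Submodule.mem_sup.1 hv
    have hv' : v = ⟨a, ha.1⟩ + ⟨b, hb.1⟩ := Subtype.ext hab.symm
    rw [hv']
    exact Submodule.add_mem _ (Submodule.subset_span (Or.inl ha.2)) (Submodule.subset_span (Or.inr hb.2))
  have hE : weilClassesMinus A φ n d = Submodule.span ℂ
      ((wedgeToCup ℂ (ComplexPoints A.X) (2 * n)) '' ((exteriorPower.map (2 * n) V.subtype) ''
        (exteriorPower.ιMulti ℂ (2 * n) '' {a : Fin (2 * n) → V | Set.range a ⊆ P}))) := by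
    rw [weilClassesMinus_eq_map_range hd hφ n, LinearMap.range_eq_map, ← hV,
      ← exteriorPower.ιMulti_span_of_span ℂ (2 * n) V hPspan, Submodule.map_span, Submodule.map_span]
  conv_lhs => rw [hE]
  rw [Submodule.span_le]
  rintro _ ⟨_, ⟨_, ⟨a, ha, rfl⟩, rfl⟩, rfl⟩
  refine Submodule.subset_span ⟨?_, ?_⟩
  · rw [hE]
    exact Submodule.subset_span ⟨_, ⟨_, ⟨a, ha, rfl⟩, rfl⟩, rfl⟩
  · rw [exteriorPower.map_apply_ιMulti, wedgeToCup_ιMulti]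
    let p : Fin (2 * n) → ℕ := fun i => if (a i : complexBetti A.X 1) ∈ hodgeOneZero hX then 1 else 0
    let q : Fin (2 * n) → ℕ := fun i => if (a i : complexBetti A.X 1) ∈ hodgeOneZero hX then 0 else 1
    have hw : ∀ i, IsOfHodgeType m A.X 1 (p i) (q i) ((⇑V.subtype ∘ a) i) := by
      intro i
      by_cases hi : (a i : complexBetti A.X 1) ∈ hodgeOneZero hX
      · simp only [p, q, if_pos hi]; exact hi
      · simp only [p, q, if_neg hi]; exact (ha ⟨i, rfl⟩).resolve_left hi
    have hpq : ∀ i, p i + q i = 1 := fun i => by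
      by_cases hi : (a i : complexBetti A.X 1) ∈ hodgeOneZero hX
      · simp only [p, q, if_pos hi]
      · simp only [p, q, if_neg hi]
    refine ⟨∑ i, p i, ∑ i, q i, ?_, isOfHodgeType_cupPowOne hX (by omega) _ p q hw⟩
    rw [← Finset.sum_add_distrib, Finset.sum_congr rfl fun i _ => hpq i, Finset.sum_const, Finset.card_univ,
      Fintype.card_fin, smul_eq_mul, mul_one]

/-- `T² + d` is irreducible over `ℚ` (`Polynomial.map` form). [cite: vanGeemen1994HodgeAV, 4.9] -/
theorem irreducible_map_X_sq_add_C (hd : 0 < d) :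
    Irreducible ((X ^ 2 + C (d : ℤ) : ℤ[X]).map (Int.castRingHom ℚ)) := by
  rw [Polynomial.map_add, Polynomial.map_pow, Polynomial.map_X, Polynomial.map_C, eq_intCast, Int.cast_natCast]
  exact irreducible_X_sq_add_C_rat hd

/-- `P(φ) = 0` for `P = T² + d` when `φ ≫ φ = -d`. [cite: vanGeemen1994HodgeAV, 4.9] -/
theorem eval₂_X_sq_add_C_eq_zero_of_sq (hφ : φ ≫ φ = -(d • 𝟙 A)) :
    Polynomial.eval₂ (Int.castRingHom (CategoryTheory.End A)) (End.of φ) (X ^ 2 + C (d : ℤ)) = 0 :=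
  (eval₂_X_sq_add_C_End_eq_zero_iff φ d).2 hφ

/-- **`⋀^{2n}W ⊕ ⋀^{2n}W^* = W_K ⊗ ℂ` is spanned by its rational classes**, in every degree `2n` and for every
`(A, φ)` with `φ² = -d`, `d > 0` (Moonen–Zarhin §1: `W_F ⊗ ℂ = ⊕_σ ⋀^r V_{ℂ,σ}` is the complexification of
`W_F ⊂ H^r(X, ℚ)`; the tree's `weilClassesField_le_span_isRationalClass` at `P = T² + d`).
[cite: MoonenZarhin1998WeilClasses, §1] [cite: vanGeemen1994HodgeAV, 4.9] -/
theorem weilClassesOf_le_span_isRationalClass (hd : 0 < d) (hφ : φ ≫ φ = -(d • 𝟙 A)) (n : ℕ) :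
    weilClassesOf A φ n d ≤ Submodule.span ℂ {c | c ∈ weilClassesOf A φ n d ∧ IsRationalClass c} := by
  rw [← weilClassesField_X_sq_add_C_eq_weilClassesOf]
  exact weilClassesField_le_span_isRationalClass (irreducible_map_X_sq_add_C hd)
    (eval₂_X_sq_add_C_eq_zero_of_sq hφ) (2 * n)

end Spans

/-! ## §4 The Calabi–Yau form `T = (𝟙 + σ^*)(⋀⁴W^*)` of an eightfold with an anti-commuting involution -/

section CYForm

variable {A : AbelianVariety ℂ} {d : ℕ} {φ σ : A ⟶ A}

/-- **A CY form from an anti-commuting involution.** For a complex abelian variety `A` of dimension `8` with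
`φ ≫ φ = -d` (`d > 0`) and an endomorphism `σ` with `σ ≫ φ = -(φ ≫ σ)`, `σ ≫ σ = 𝟙`, the subspace
`T = (𝟙 + σ^*)(⋀⁴W^*) ⊂ H⁴(A(ℂ); ℂ)` satisfies the five `T`-clauses of crux X1 `CYFormCarrierEight`
(`IsCYFormAt d A φ T` of the skeleton `Lines/birth.lean`, inlined verbatim): `T ≤ ⋀⁴W ⊔ ⋀⁴W^*`, `T ⊓ ⋀⁴W = ⊥`,
`dim T = 70`, `T` spanned by its rational classes and by its pure-type classes. (Friedman–Laza's `Fix(⋆)` with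
the geometric involution `σ^*` in place of the Hodge star.) [cite: FriedmanLaza2013, §3.5 Prop. 37 and §2.4.2]
[cite: vanGeemen1994HodgeAV, 4.9 and proof of Thm. 6.12] [cite: MoonenZarhin1998WeilClasses, §1] -/
theorem exists_cyForm_of_antiInvolution (hd : 0 < d) (hA : A.dim = 2 * 4) (hφ : φ ≫ φ = -(d • 𝟙 A))
    (hσ : σ ≫ φ = -(φ ≫ σ)) (hσσ : σ ≫ σ = 𝟙 A) :
    ∃ T : Submodule ℂ (complexBetti A.X (2 * 2)),
      T ≤ pullbackEigenclasses A φ (2 * 2)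
            (fun x y => ((x : ℂ) + (y : ℂ) * Complex.I * (Real.sqrt d : ℂ)) ^ 4) ⊔
          pullbackEigenclasses A φ (2 * 2)
            (fun x y => ((x : ℂ) - (y : ℂ) * Complex.I * (Real.sqrt d : ℂ)) ^ 4) ∧
      T ⊓ pullbackEigenclasses A φ (2 * 2)
            (fun x y => ((x : ℂ) + (y : ℂ) * Complex.I * (Real.sqrt d : ℂ)) ^ 4) = ⊥ ∧
      Module.finrank ℂ T = 70 ∧
      T ≤ Submodule.span ℂ {c | c ∈ T ∧ IsRationalClass c} ∧
      T ≤ Submodule.span ℂ {c | c ∈ T ∧ ∃ p q : ℕ, p + q = 4 ∧ IsOfHodgeType (2 * 4) A.X (2 * 2) p q c} := by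
  have hX : IsSmoothProjective (2 * 4) A.X := isSmoothProjective_of_dim_eq' hA
  set s : complexBetti A.X (2 * 2) →ₗ[ℂ] complexBetti A.X (2 * 2) := (complexBetti.map σ.hom.hom.hom (2 * 2)).hom
    with hs_def
  set Ep := weilClassesPlus A φ 2 d with hEp
  set Em := weilClassesMinus A φ 2 d with hEm
  have hs : Em.map s ≤ Ep := map_weilClassesMinus_le_weilClassesPlus hd hφ hσ 2
  have hs' : Ep.map s ≤ Em := map_weilClassesPlus_le_weilClassesMinus hd hφ hσ 2
  have h0 : Ep ⊓ Em = ⊥ := weilClassesPlus_inf_weilClassesMinus two_pos hd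
  have hss : ∀ x, s (s x) = x := map_map_of_comp_self_eq_id hσσ (2 * 2)
  refine ⟨Em.map (LinearMap.id + s), map_id_add_le_sup s Ep Em hs, map_id_add_inf_eq_bot s Ep Em hs h0,
    ?_, ?_, ?_⟩
  · haveI := finite_complexBetti_abelianVariety A (2 * 2)
    rw [finrank_map_id_add s Ep Em hs h0, hEm, finrank_weilClassesMinus_eq_choose hd hφ 2,
      finrank_eigenspace_neg_eq_dim hd hφ, hA]
    decide
  · have h1 := map_le_span_sep (LinearMap.id + s) (Ep ⊔ Em) (fun c => IsRationalClass c)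
      (fun c hc => by
        rw [LinearMap.add_apply, LinearMap.id_apply]
        exact hc.add (hc.map _))
      (weilClassesOf_le_span_isRationalClass hd hφ 2)
    rwa [map_id_add_sup_eq s Ep Em hs' hss] at h1
  · have h1 := map_le_span_sep (LinearMap.id + s) Em
      (fun c => ∃ p q : ℕ, p + q = 2 * 2 ∧ IsOfHodgeType (2 * 4) A.X (2 * 2) p q c)
      (fun c hc => by
        obtain ⟨p, q, hpq, hc⟩ := hc
        refine ⟨p, q, hpq, ?_⟩
        rw [LinearMap.add_apply, LinearMap.id_apply]
        exact hc.add hX (hc.map_of_isSmoothProjective hX hX σ.hom.hom.hom))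
      (weilClassesMinus_le_span_pureType hd hφ hX two_pos)
    exact h1

end CYForm

end Summit.HodgeConjecture.HodgeConjecture.Theorems.CYFormCarrier

end
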